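import Mathlib
import HarnessLib
import Literature.Analysis.ValidatedNumerics.IntervalLogArctan
import Summits.KontsevichZagierPeriods.Zeta5Search.TwoTaleP15SecondLineCertificate
import Summits.KontsevichZagierPeriods.Zeta5Search.TwoTaleD1SecondLineProfileShape

/-!
# Two-point tangent certificate for the second-tale line profile at RUNG D1 = L(1/3) (DecayTD1, one-variable side)

HONEST FRAMING: systematic search; no irrationality claim unless certified.  This file proves an
inequality about an explicit elementary function of one real variable; no statement about
`ζ(2)`, `ζ(5)` or any linear form is made here.  Cell pub-zeta5 (P1 g12; file M6 of fam-denom's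
`families/denom/D1-DESIGN-NOTE.md`, design `families/measure/D1-DECAYT-DESIGN.md` §5 (fam-measure g7), P15
precedent `TwoTaleP15SecondLineCertificate` (P1 g10), whose GENERIC evaluators `legA100/legG100/sumA100/sumG100/
realA100/realG100` (abscissae `p/100`, integer weights) and soundness lemmas are reused verbatim, as are the scale
`sc = 2^56`, `KL`, `KA`, `mem_zero` of `Denom/TwoTaleP15LineCertificate`).
With `PTD = profileTD1 (−1318/100)` and `DTD = angleTD1 (−1318/100) − 2π` (`TwoTaleD1SecondLineProfileShape.lean`),
the two-point lemma `twoPointTD` reduces `sup_{η>0} PTD ≤ c` to three facts at two rational points, certified at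
`η₁ = 18695/10000`, `η₂ = 18702/10000` (design optimum `η* = 1.86981`): legs `legsTD1`, constant enclosure
`constGTD1` of `32 log 16 − 25 log 25 − 7 log 7 + 25 log 2`, Boolean test `certCheckTD1` (`decide +kernel`) and its
soundness, giving
* `profileTD1_le : η ≠ 0 → profileTD1 (−1318/100) η ≤ −42.33437` (design supremum `−42.3343781` on this line, saddle
  `−42.33438300`; two-point bound `−42.3343779`), and WITH SLACK
* `certTD1_delta : 0 ≤ δ → δ ≤ 3 → η ≠ 0 → profileTD10 (−1318/100) η − (2π − δ)|η| ≤ −42.33437 + 11 δ`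
  (concavity on `(0, 11]` and the tail slope `PTD_tail`),
the one-variable input of the second-tale decay `DecayTD1 c′`, `c′ < 42.33437` (the W1 coincidence at D1 needs
`c′ ≥ 40.6`).  Design numerics (two implementations): fam-measure `rateT_D1.py`, P1 `HOME/code/p1/g12/d1_tale2_profile.py`.
Nothing here is conjectural.
-/

noncomputable section

open Real Set

namespace Summit.KontsevichZagierPeriods.Zeta5Search.TwoTaleD1SecondLineCertificate

open Summit.KontsevichZagierPeriods.Zeta5Search.Denom.LineProfile
open Summit.KontsevichZagierPeriods.Zeta5Search.TwoTaleD1SecondLineProfileShape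
open Summit.KontsevichZagierPeriods.Zeta5Search.Denom.TwoTaleP15LineCertificate
  (sc sc_pos KL KA mem_zero)
open Summit.KontsevichZagierPeriods.Zeta5Search.TwoTaleP15SecondLineCertificate
  (legA100 legG100 sumA100 sumG100 realA100 realG100 mem_sumA100 mem_sumG100)
open Literature.Analysis.ValidatedNumerics.NumericsMP

/-- The eight legs `(p, weight)` of the D1 second-tale profile at `ξ = −1318/100` (abscissae `p/100`):
doubled numerator block `10.32, 2.18` (weight `2`), numerator block `2.82, 4.18`, denominator blocks
`(5.82 ‖ 21.82)`, `(8.82 ‖ 24.82)`. -/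
def legsTD1 : List (ℤ × ℤ) :=
  [(1032, 2), (218, 2), (282, 1), (418, 1), (2182, -1), (582, 1), (2482, -1), (882, 1)]

/-- `realA100 η legsTD1 = angleTD1 (−1318/100) η = DTD η + 2π`. -/
theorem realA100_legsTD1 (η : ℝ) : realA100 η legsTD1 = DTD η + 2 * Real.pi := by
  rw [DTD_eq]
  simp only [realA100, legsTD1, numLegsTD, denAngleTD1, denAngleTD2]
  push_cast
  ring

/-- `realG100 η legsTD1 + profileTD1Const − 2π|η| = PTD η`. -/
theorem realG100_legsTD1 (η : ℝ) :
    realG100 η legsTD1 + profileTD1Const - 2 * Real.pi * |η| = PTD η := by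
  rw [PTD_eq]
  simp only [realG100, legsTD1]
  push_cast
  ring

/-- Enclosure of `profileTD1Const = 32 log 16 − 25 log 25 − 7 log 7 + 25 log 2`. -/
def constGTD1 : Option MI :=
  match MI.logNat2 sc KL 16, MI.logNat2 sc KL 25, MI.logNat2 sc KL 7, MI.logNat2 sc KL 2 with
  | some A, some B, some C, some D =>
    some ((((A.mulInt 32).sub (B.mulInt 25)).sub (C.mulInt 7)).add (D.mulInt 25))
  | _, _, _, _ => none

/-- Soundness of `constGTD1`. -/
theorem mem_constGTD1 {C : MI} (h : constGTD1 = some C) : MI.mem sc profileTD1Const C := by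
  unfold constGTD1 at h
  split at h
  · rename_i A B C' D hA hB hC hD
    simp only [Option.some.injEq] at h
    subst h
    have key := MI.mem_add (MI.mem_sub (MI.mem_sub
      (MI.mem_mulInt (MI.mem_logNat2 sc_pos hA) 32) (MI.mem_mulInt (MI.mem_logNat2 sc_pos hB) 25))
      (MI.mem_mulInt (MI.mem_logNat2 sc_pos hC) 7)) (MI.mem_mulInt (MI.mem_logNat2 sc_pos hD) 25)
    have e : Real.log ((16 : ℕ) : ℝ) * ((32 : ℤ) : ℝ) - Real.log ((25 : ℕ) : ℝ) * ((25 : ℤ) : ℝ)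
        - Real.log ((7 : ℕ) : ℝ) * ((7 : ℤ) : ℝ) + Real.log ((2 : ℕ) : ℝ) * ((25 : ℤ) : ℝ)
        = profileTD1Const := by
      simp only [profileTD1Const]
      push_cast
      ring
    rw [e] at key
    exact key
  · simp at h

/-- `η₁ = 18695/10000 = 1.8695`. -/
def etaOneTD1 : MI := MI.ofFrac sc 18695 10000

/-- `η₂ = 18702/10000 = 1.8702`. -/
def etaTwoTD1 : MI := MI.ofFrac sc 18702 10000

/-- The kernel test: `DTD η₁ ≥ 0`, `DTD η₂ ≤ 0`, and `PTD η₁ + DTD η₁ (η₂ − η₁) ≤ −42.33437`, as integer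
inequalities between enclosure ends (`10000·(PTD η₁ + DTD η₁·7/10000) = 10000 (G + C) + 7 A1 − 37404 π`,
`A1 = DTD η₁ + 2π`). -/
def certCheckTD1 : Bool :=
  match MI.pi sc KA with
  | some piI =>
    match sumA100 piI etaOneTD1 legsTD1, sumA100 piI etaTwoTD1 legsTD1, sumG100 piI etaOneTD1 legsTD1,
      constGTD1 with
    | some A1, some A2, some G1, some C =>
      decide (2 * piI.hi ≤ A1.lo) && (decide (A2.hi ≤ 2 * piI.lo) &&
        decide (10 ^ 5 * (10000 * (G1.hi + C.hi) + 7 * A1.hi - 37404 * piI.lo)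
          ≤ -(4233437 * 10000 * (sc : ℤ))))
    | _, _, _, _ => false
  | none => false

/-- The kernel test passes (kernel evaluation of the interval engine). -/
theorem certCheckTD1_eq : certCheckTD1 = true := by
  decide +kernel

/-- Soundness of the kernel test. -/
theorem certCheckTD1_sound (h : certCheckTD1 = true) :
    0 ≤ DTD (18695 / 10000) ∧ DTD (18702 / 10000) ≤ 0 ∧
      PTD (18695 / 10000) + DTD (18695 / 10000) * (18702 / 10000 - 18695 / 10000) ≤ -42.33437 := by
  unfold certCheckTD1 at h
  split at h
  · rename_i piI hpiI
    split at h
    · rename_i A1 A2 G1 C hA1 hA2 hG1 hC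
      simp only [Bool.and_eq_true, decide_eq_true_eq] at h
      obtain ⟨i1, i2, i3⟩ := h
      have hS : (0 : ℝ) < sc := by exact_mod_cast sc_pos
      have hpi := MI.mem_pi sc hpiI
      have hE1 : MI.mem sc (18695 / 10000 : ℝ) etaOneTD1 := by
        simpa [etaOneTD1] using MI.mem_ofFrac sc 18695 (by norm_num : 0 < 10000)
      have hE2 : MI.mem sc (18702 / 10000 : ℝ) etaTwoTD1 := by
        simpa [etaTwoTD1] using MI.mem_ofFrac sc 18702 (by norm_num : 0 < 10000)
      have mA1 := mem_sumA100 hpi hE1 legsTD1 hA1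
      have mA2 := mem_sumA100 hpi hE2 legsTD1 hA2
      have mG1 := mem_sumG100 hpi hE1 legsTD1 hG1
      have mC := mem_constGTD1 hC
      rw [realA100_legsTD1] at mA1 mA2
      have c1 : (2 : ℝ) * piI.hi ≤ A1.lo := by exact_mod_cast i1
      have c2 : (A2.hi : ℝ) ≤ 2 * piI.lo := by exact_mod_cast i2
      have c3 : (10 : ℝ) ^ 5 * (10000 * ((G1.hi : ℝ) + C.hi) + 7 * A1.hi - 37404 * piI.lo)
          ≤ -(4233437 * 10000 * (sc : ℝ)) := by
        exact_mod_cast i3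
      have eP := realG100_legsTD1 (18695 / 10000 : ℝ)
      rw [abs_of_pos (by norm_num : (0 : ℝ) < 18695 / 10000)] at eP
      unfold MI.mem at hpi mA1 mA2 mG1 mC
      refine ⟨?_, ?_, ?_⟩
      · have key : (2 * Real.pi) * sc ≤ (DTD (18695 / 10000) + 2 * Real.pi) * sc := by
          linarith [hpi.2, mA1.1]
        nlinarith [le_of_mul_le_mul_right key hS]
      · have key : (DTD (18702 / 10000) + 2 * Real.pi) * sc ≤ (2 * Real.pi) * sc := by
          linarith [hpi.1, mA2.2]
        nlinarith [le_of_mul_le_mul_right key hS]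
      · rw [← eP]
        have hD : DTD (18695 / 10000) * sc ≤ (A1.hi : ℝ) - 2 * piI.lo := by
          have := mA1.2
          linarith [hpi.1]
        have key : (realG100 (18695 / 10000) legsTD1 + profileTD1Const - 2 * Real.pi * (18695 / 10000)
            + DTD (18695 / 10000) * (18702 / 10000 - 18695 / 10000)) * sc
            ≤ (-42.33437 : ℝ) * sc := by
          nlinarith [mG1.2, mC.2, hpi.1, hD]
        exact le_of_mul_le_mul_right key hS
    · simp at h
  · simp at h

/-- **The certificate**: `profileTD1 (−1318/100) η ≤ −42.33437` for every `η > 0`. -/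
theorem profileTD1_le_of_pos {η : ℝ} (hη : 0 < η) : profileTD1 (-1318 / 100) η ≤ -42.33437 := by
  obtain ⟨hD1, hD2, hP⟩ := certCheckTD1_sound certCheckTD1_eq
  have h := twoPointTD (by norm_num) (by norm_num) (by norm_num) hD1 hD2 hη
  exact h.trans hP

/-- `profileTD1 (−1318/100) η ≤ −42.33437` for every `η ≠ 0` (evenness). -/
theorem profileTD1_le {η : ℝ} (hη : η ≠ 0) : profileTD1 (-1318 / 100) η ≤ -42.33437 := by
  rcases lt_or_gt_of_ne hη with h | h
  · rw [← profileTD1_neg_eta]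
    exact profileTD1_le_of_pos (neg_pos.2 h)
  · exact profileTD1_le_of_pos h

/-! ## The certificate with slack -/

/-- On `η > 0`: `profileTD10 (−1318/100) η − (2π − δ) η ≤ −42.33437 + 11 δ` for `0 ≤ δ ≤ 3`
(concavity up to `η = 11`, the tail slope `PTD_tail` beyond). -/
theorem certTD1_of_pos {δ : ℝ} (hδ0 : 0 ≤ δ) (hδ3 : δ ≤ 3) {η : ℝ} (hη : 0 < η) :
    profileTD10 (-1318 / 100) η - (2 * π - δ) * η ≤ -42.33437 + 11 * δ := by
  have hP : profileTD10 (-1318 / 100) η - (2 * π - δ) * η = PTD η + δ * η := by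
    simp only [PTD, profileTD1, abs_of_pos hη]
    ring
  rw [hP]
  rcases le_or_gt η 11 with h11 | h11
  · have h1 : PTD η ≤ -42.33437 := profileTD1_le_of_pos hη
    nlinarith
  · have ht := PTD_tail h11.le
    have h11v : PTD 11 ≤ -42.33437 := profileTD1_le_of_pos (by norm_num)
    nlinarith

/-- **The `δ`-certificate**: for `0 ≤ δ ≤ 3` and every `η ≠ 0`,
`profileTD10 (−1318/100) η − (2π − δ)|η| ≤ −42.33437 + 11 δ`. -/
theorem certTD1_delta {δ : ℝ} (hδ0 : 0 ≤ δ) (hδ3 : δ ≤ 3) (η : ℝ) (hη : η ≠ 0) :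
    profileTD10 (-1318 / 100) η - (2 * π - δ) * |η| ≤ -42.33437 + 11 * δ := by
  rcases lt_or_gt_of_ne hη with h | h
  · have h' : 0 < -η := by linarith
    have hc := certTD1_of_pos hδ0 hδ3 h'
    rw [profileTD10_neg_eta] at hc
    rw [abs_of_neg h]
    linarith
  · rw [abs_of_pos h]
    exact certTD1_of_pos hδ0 hδ3 h

end Summit.KontsevichZagierPeriods.Zeta5Search.TwoTaleD1SecondLineCertificate

end
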